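import Summits.PneNP.PneNP.Theses.KarlinRubin
import Summits.PneNP.PneNP.Theorems.PlantedCliqueErdosRenyiNoLargeClique
import Literature.Computability.Complexity.CircuitLowerBoundsProofs

/-!
# Route KarlinRubin — `MonotoneSuffices` (stmt-PneNP-18026): the brute-force end

The conclusion of `MonotoneSuffices` at `(δ, a, s)` asks for a family of `{∧₂, ∨₂, 0, 1}`-circuits
of size `≤ (s(n)+n)^a` strongly detecting the planted `⌈n^{1/2-δ}⌉`-clique at density `1/2`.
The exact monotone clique search — the OR over all `t`-sets of the AND of their edges, with
`t(n) = 3⌊log₂ n⌋ + 3` — is such a family of size `≤ C(n,t)·(C(n,2)+1) ≤ n^{t+2}`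
(`exists_sized_monotone_cliqueCircuit`): its type-II error vanishes eventually (the planted
clique contains a `t`-clique once `t ≤ ⌈n^{1/2-δ}⌉`) and its type-I error tends to `0` by the
first-moment bound `ErdosRenyiNoLargeClique` (proved, route PlantedClique). Hence
`karlinRubin_bruteForce_monotone_detector` and: the implication `MonotoneSuffices` holds at every
`(δ, a, s)` with `n^{3⌊log₂ n⌋+5} ≤ (s(n)+n)^a` eventually
(`karlinRubin_monotoneSuffices_of_large_budget`). With the locality barrier
(`KarlinRubinMonotoneSufficesLocality.lean`: budgets `o(n^{1+2δ})` are vacuous) this brackets the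
open range of the item. Helpers for stmt-PneNP-18026 (`--supports`).
-/

set_option linter.dupNamespace false -- `Summit.PneNP.PneNP.…`: summit = sub-problem name (D-0017 single-conjunct layout)

namespace Summit.PneNP.PneNP.Theorems

open Filter Topology Finset
open scoped ENNReal
open Literature.Computability.Complexity Literature.Probability.RandomGraphs.PlantedClique

/-- **The exact monotone clique circuit, with its size.** For `2 ≤ k ≤ n`, the OR over all
`k`-sets `S` of the AND of the edges inside `S` is a `{∧₂, ∨₂}`-circuit with at most
`C(n,k)·(C(n,2)+1)` gates computing `CLIQUE(n,k)` (the construction of the library's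
`exists_monotone_computes_cliqueFn_holds`, with the gate count kept).
-- adapted from Summits/PneNP/PneNP/Cruxes/SingleThreshold/Disproof.lean (`exists_monotone_cliqueCircuit`)
[folklore] -/
theorem exists_sized_monotone_cliqueCircuit {n k : ℕ} (h2 : 2 ≤ k) (hkn : k ≤ n) :
    ∃ C : Circuit ((⊤ : SimpleGraph (Fin n)).edgeSet), C.IsOver monotoneBasis ∧
      C.size ≤ n.choose k * (n.choose 2 + 1) ∧ ∀ x, C.eval x = cliqueFn n k x := by
  classical
  set T : Finset (Finset (Fin n)) := powersetCard k univ with hT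
  let E : Finset (Fin n) → List ((⊤ : SimpleGraph (Fin n)).edgeSet) := fun S =>
    (univ.filter fun e => IsLive S e).toList
  have hcardE : Fintype.card ((⊤ : SimpleGraph (Fin n)).edgeSet) = n.choose 2 := by
    rw [← SimpleGraph.edgeFinset_card, SimpleGraph.card_edgeFinset_top_eq_card_choose_two,
      Fintype.card_fin]
  have hElen : ∀ S, (E S).length ≤ n.choose 2 := by
    intro S
    simp only [E, Finset.length_toList]
    exact (card_le_card (filter_subset _ _)).trans_eq (by rw [card_univ, hcardE])
  have hEne : ∀ S ∈ T, E S ≠ [] := by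
    intro S hS
    have hScard : #S = k := (mem_powersetCard.1 hS).2
    obtain ⟨u, hu, v, hv, huv⟩ := one_lt_card.1 (by omega : 1 < #S)
    have he : s(u, v) ∈ (⊤ : SimpleGraph (Fin n)).edgeSet := (SimpleGraph.mem_edgeSet _).2 huv
    intro hnil
    have : (⟨s(u, v), he⟩ : (⊤ : SimpleGraph (Fin n)).edgeSet) ∈ E S :=
      Finset.mem_toList.2 (mem_filter.2 ⟨mem_univ _, (isLive_mk he).2 ⟨hu, hv⟩⟩)
    rw [hnil] at this
    simp at this
  have hTcard : #T = n.choose k := by rw [hT, card_powersetCard, card_univ, Fintype.card_fin]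
  have hTne : T.Nonempty := powersetCard_nonempty.2 (by simpa using hkn)
  -- stage 1: all the ANDs in parallel
  have h1 : CktSize monotoneBasis
      (fun (x : (⊤ : SimpleGraph (Fin n)).edgeSet → Bool) (S : T) => (E S).all fun e => x e)
      (∑ S : T, (E S).length) :=
    CktSize.pi fun S => cktSize_all (E S) (hEne S S.2)
  -- stage 2: the OR of the results
  have hUne : (univ : Finset T).toList ≠ [] := by
    obtain ⟨S, hS⟩ := hTne
    intro hnil
    have := Finset.mem_toList.2 (mem_univ (⟨S, hS⟩ : T))
    rw [hnil] at this
    simp at this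
  have h2' := h1.comp (cktSize_any (ι := T) (univ : Finset T).toList hUne)
  obtain ⟨C, hCB, hsize, hCev⟩ := h2'.toCircuit
  refine ⟨C, hCB, ?_, fun x => ?_⟩
  · -- size bookkeeping
    refine hsize.trans ?_
    have hsum : ∑ S : T, (E S).length ≤ n.choose k * n.choose 2 := by
      calc ∑ S : T, (E S).length ≤ ∑ _S : T, n.choose 2 := sum_le_sum fun S _ => hElen S
        _ = n.choose k * n.choose 2 := by
            rw [sum_const, card_univ, Fintype.card_coe, hTcard, smul_eq_mul]
    rw [Finset.length_toList, card_univ, Fintype.card_coe, hTcard]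
    calc ∑ S : T, (E S).length + n.choose k ≤ n.choose k * n.choose 2 + n.choose k :=
          Nat.add_le_add_right hsum _
      _ = n.choose k * (n.choose 2 + 1) := by ring
  · rw [hCev]
    apply Bool.eq_iff_iff.2
    rw [cliqueFn_eq_true_iff_exists, List.any_eq_true]
    constructor
    · rintro ⟨S, -, hS⟩
      rw [List.all_eq_true] at hS
      refine ⟨S, (mem_powersetCard.1 S.2).2, fun e he => hS e ?_⟩
      exact Finset.mem_toList.2 (mem_filter.2 ⟨mem_univ _, he⟩)
    · rintro ⟨S, hS, hx⟩
      have hST : S ∈ T := mem_powersetCard.2 ⟨subset_univ _, hS⟩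
      refine ⟨⟨S, hST⟩, Finset.mem_toList.2 (mem_univ _), ?_⟩
      rw [List.all_eq_true]
      intro e he
      exact hx e (mem_filter.1 (Finset.mem_toList.1 he)).2

/-- The exact circuit has at most `n^{k+2}` gates (`1 ≤ n`). [folklore] -/
theorem choose_mul_choose_two_succ_le_pow (n k : ℕ) (hn : 1 ≤ n) :
    n.choose k * (n.choose 2 + 1) ≤ n ^ (k + 2) := by
  have h1 : n.choose k ≤ n ^ k := Nat.choose_le_pow n k
  have h2 : n.choose 2 + 1 ≤ n ^ 2 := by
    have ha : n.choose 2 ≤ n * (n - 1) := by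
      rw [Nat.choose_two_right]; exact Nat.div_le_self _ _
    have hb : n * (n - 1) + 1 ≤ n ^ 2 := by
      obtain ⟨m, rfl⟩ : ∃ m, n = m + 1 := ⟨n - 1, by omega⟩
      simp only [Nat.add_sub_cancel]
      nlinarith
    omega
  calc n.choose k * (n.choose 2 + 1) ≤ n ^ k * n ^ 2 := Nat.mul_le_mul h1 h2
    _ = n ^ (k + 2) := (pow_add n k 2).symm

/-- `CLIQUE(n,t)(x) = 1` iff the graph of the edge vector `x` has a `t`-clique, in the
vocabulary of `PlantedClique.lean`. [folklore] -/
theorem cliqueFn_eq_true_iff_exists_isClique {n t : ℕ} (x : EdgeVec n) :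
    cliqueFn n t x = true ↔
      ∃ S : Finset (Fin n), S.card = t ∧ (graphOfEdgeVec x).IsClique (S : Set (Fin n)) := by
  rw [cliqueFn_eq_true_iff]
  simp only [SimpleGraph.CliqueFree, not_forall, not_not]
  constructor
  · rintro ⟨S, hS⟩
    exact ⟨S, hS.card_eq, hS.isClique⟩
  · rintro ⟨S, h1, h2⟩
    exact ⟨S, ⟨h2, h1⟩⟩

/-- `3 log₂ n + 3 ≤ n^β` and `≤ n` eventually, for every `β > 0` (the clique size of the brute-force
detector fits under the planted clique size `⌈n^{1/2-δ}⌉`). [folklore] -/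
theorem eventually_three_log_le_rpow {β : ℝ} (hβ : 0 < β) (hβ1 : β ≤ 1) :
    ∀ᶠ n : ℕ in atTop, 3 * Nat.log 2 n + 3 ≤ ⌈(n : ℝ) ^ β⌉₊ ∧ 3 * Nat.log 2 n + 3 ≤ n := by
  have h1 : Tendsto (fun n : ℕ => Real.log (n : ℝ) / (n : ℝ) ^ β) atTop (nhds 0) :=
    ((isLittleO_log_rpow_atTop hβ).comp_tendsto tendsto_natCast_atTop_atTop).tendsto_div_nhds_zero
  have h2 : ∀ᶠ n : ℕ in atTop, Real.log (n : ℝ) / (n : ℝ) ^ β < Real.log 2 / 6 :=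
    h1.eventually (gt_mem_nhds (by positivity))
  have h3 : ∀ᶠ n : ℕ in atTop, (6 : ℝ) ≤ (n : ℝ) ^ β :=
    ((tendsto_rpow_atTop hβ).comp tendsto_natCast_atTop_atTop).eventually_ge_atTop 6
  filter_upwards [h2, h3, eventually_ge_atTop 1] with n h2 h3 hn1
  have hnpos : (0 : ℝ) < n := by exact_mod_cast hn1
  have hrpos : 0 < (n : ℝ) ^ β := Real.rpow_pos_of_pos hnpos _
  have hlog2 : 0 < Real.log 2 := Real.log_pos one_lt_two
  have hnat : ((Nat.log 2 n : ℕ) : ℝ) ≤ Real.logb 2 (n : ℝ) := by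
    rw [Real.le_logb_iff_rpow_le (by norm_num) hnpos, Real.rpow_natCast]
    exact_mod_cast Nat.pow_log_le_self 2 (by omega)
  have hlogb_le : Real.logb 2 (n : ℝ) ≤ (n : ℝ) ^ β / 6 := by
    rw [Real.logb, div_le_div_iff₀ hlog2 (by norm_num : (0:ℝ) < 6)]
    have := (div_lt_iff₀ hrpos).1 h2
    nlinarith
  have hreal : ((3 * Nat.log 2 n + 3 : ℕ) : ℝ) ≤ (n : ℝ) ^ β := by
    push_cast
    nlinarith
  constructor
  · have : ((3 * Nat.log 2 n + 3 : ℕ) : ℝ) ≤ (⌈(n : ℝ) ^ β⌉₊ : ℝ) := hreal.trans (Nat.le_ceil _)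
    exact_mod_cast this
  · have hle : (n : ℝ) ^ β ≤ n := by
      conv_rhs => rw [← Real.rpow_one (n : ℝ)]
      exact Real.rpow_le_rpow_of_exponent_le (by exact_mod_cast hn1) hβ1
    exact_mod_cast hreal.trans hle

/-- **The brute-force monotone detector.** For `0 < δ < 1/2` there is a family of
`{∧₂, ∨₂, 0, 1}`-circuits of size `≤ n^{3⌊log₂ n⌋ + 5}` (eventually) whose type-I error on
`G(n,1/2)` plus type-II error on the planted `⌈n^{1/2-δ}⌉`-clique tends to `0`: the exact
`CLIQUE(n, 3⌊log₂ n⌋+3)` circuit (type II `= 0` eventually since the planted clique contains such a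
clique; type I `→ 0` by the first-moment bound `ErdosRenyiNoLargeClique`, proved in
`PlantedCliqueErdosRenyiNoLargeClique.lean`). [folklore] -/
theorem karlinRubin_bruteForce_monotone_detector {δ : ℝ} (hδ : 0 < δ) (hδ' : δ < 1 / 2) :
    ∃ M : (n : ℕ) → Circuit ((⊤ : SimpleGraph (Fin n)).edgeSet),
      (∀ᶠ n : ℕ in atTop, (M n).IsOver monotoneBasis01 ∧ (M n).size ≤ n ^ (3 * Nat.log 2 n + 5)) ∧
      Tendsto (fun n : ℕ => (erdosRenyiHalf n).toOuterMeasure {x | (M n).eval x = true} +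
        (plantedCliqueDist n ⌈(n : ℝ) ^ (1 / 2 - δ)⌉₊).toOuterMeasure {x | (M n).eval x = false})
        atTop (nhds 0) := by
  classical
  -- the clique size `t n = 3 ⌊log₂ n⌋ + 3`
  set t : ℕ → ℕ := fun n => 3 * Nat.log 2 n + 3 with ht
  have ht_logb : ∀ n : ℕ, (2 + 1) * Real.logb 2 (n : ℝ) ≤ (t n : ℝ) := by
    intro n
    rcases Nat.eq_zero_or_pos n with hn | hn
    · subst hn
      simp [t]
    · have hlt : (n : ℝ) < (2 : ℝ) ^ ((Nat.log 2 n + 1 : ℕ) : ℝ) := by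
        rw [Real.rpow_natCast]
        exact_mod_cast Nat.lt_pow_succ_log_self (by norm_num : 1 < 2) n
      have hlogb : Real.logb 2 (n : ℝ) < ((Nat.log 2 n + 1 : ℕ) : ℝ) :=
        (Real.logb_lt_iff_lt_rpow (by norm_num) (by exact_mod_cast hn)).2 hlt
      have : (t n : ℝ) = 3 * ((Nat.log 2 n + 1 : ℕ) : ℝ) := by
        simp only [t]; push_cast; ring
      rw [this]
      linarith
  have hgrow : ∀ᶠ n : ℕ in atTop, t n ≤ ⌈(n : ℝ) ^ (1 / 2 - δ)⌉₊ ∧ t n ≤ n :=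
    eventually_three_log_le_rpow (β := 1 / 2 - δ) (by linarith) (by linarith)
  -- the family (junk outside the eventual range)
  let P : (n : ℕ) → Prop := fun n => 2 ≤ t n ∧ t n ≤ n
  let M : (n : ℕ) → Circuit ((⊤ : SimpleGraph (Fin n)).edgeSet) := fun n =>
    if h : P n then (exists_sized_monotone_cliqueCircuit h.1 h.2).choose else Circuit.const _ false
  have hMP : ∀ᶠ n : ℕ in atTop, (M n).IsOver monotoneBasis ∧
      (M n).size ≤ n.choose (t n) * (n.choose 2 + 1) ∧ ∀ x, (M n).eval x = cliqueFn n (t n) x := by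
    filter_upwards [hgrow] with n hg
    have hP : P n := ⟨by simp [t], hg.2⟩
    have hM : M n = (exists_sized_monotone_cliqueCircuit hP.1 hP.2).choose := dif_pos hP
    rw [hM]
    exact (exists_sized_monotone_cliqueCircuit hP.1 hP.2).choose_spec
  refine ⟨M, ?_, ?_⟩
  · filter_upwards [hMP, hgrow, eventually_ge_atTop 1] with n hn hg hn1
    refine ⟨hn.1.mono monotoneBasis_subset_monotoneBasis01, hn.2.1.trans ?_⟩
    exact choose_mul_choose_two_succ_le_pow n (t n) hn1
  · -- type-I error → 0
    have hI : Tendsto (fun n : ℕ =>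
        (erdosRenyiHalf n).toOuterMeasure {x | (M n).eval x = true}) atTop (nhds 0) := by
      have hE' := plantedClique_erdosRenyiNoLargeClique_proof t ⟨1, one_pos, Eventually.of_forall ht_logb⟩
      refine hE'.congr' ?_
      filter_upwards [hMP] with n hn
      congr 1
      ext x
      simp only [Set.mem_setOf_eq]
      rw [hn.2.2 x]
      exact (cliqueFn_eq_true_iff_exists_isClique x).symm
    -- type-II error = 0 eventually
    have hII : ∀ᶠ n : ℕ in atTop,
        (plantedCliqueDist n ⌈(n : ℝ) ^ (1 / 2 - δ)⌉₊).toOuterMeasure {x | (M n).eval x = false} = 0 := by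
      filter_upwards [hMP, hgrow] with n hn hg
      rw [PMF.toOuterMeasure_apply_eq_zero_iff, Set.disjoint_left]
      intro x hx hxf
      rw [plantedCliqueDist, PMF.support_map] at hx
      obtain ⟨p, hp, rfl⟩ := hx
      obtain ⟨hcard, hcl⟩ := mem_support_plantedCliqueJoint hp
      have hle : t n ≤ p.1.card := by rw [hcard]; exact le_min hg.1 hg.2
      obtain ⟨S, hSsub, hScard⟩ := Finset.exists_subset_card_eq hle
      have hclS : (graphOfEdgeVec p.2).IsClique (S : Set (Fin n)) := hcl.subset (by exact_mod_cast hSsub)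
      have htrue : (M n).eval p.2 = true := by
        rw [hn.2.2]
        exact (cliqueFn_eq_true_iff_exists_isClique p.2).2 ⟨S, hScard, hclS⟩
      simp only [Set.mem_setOf_eq] at hxf
      rw [htrue] at hxf
      exact Bool.noConfusion hxf
    refine hI.congr' ?_
    filter_upwards [hII] with n hn
    rw [hn, add_zero]

/-- **`MonotoneSuffices` above the brute-force threshold.** For `0 < δ < 1/2`, every exponent `a`
and every budget `s` with `n^{3⌊log₂ n⌋+5} ≤ (s(n)+n)^a` eventually, the implication asserted by
`Summit.PneNP.PneNP.Theses.KarlinRubin.MonotoneSuffices` at `(δ, a, s)` holds — its conclusion is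
met outright by `karlinRubin_bruteForce_monotone_detector`, whatever the hypothesis. [folklore] -/
theorem karlinRubin_monotoneSuffices_of_large_budget {δ : ℝ} (hδ : 0 < δ) (hδ' : δ < 1 / 2)
    (a : ℕ) (s : ℕ → ℕ) (hs : ∀ᶠ n : ℕ in atTop, n ^ (3 * Nat.log 2 n + 5) ≤ (s n + n) ^ a) :
    (∃ C : (n : ℕ) → Circuit ((⊤ : SimpleGraph (Fin n)).edgeSet),
        (∀ᶠ n : ℕ in atTop, (C n).IsOver B2 ∧ (C n).size ≤ s n) ∧
        Tendsto (fun n : ℕ => (erdosRenyiHalf n).toOuterMeasure {x | (C n).eval x = true} +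
          (plantedCliqueDist n ⌈(n : ℝ) ^ (1 / 2 - δ)⌉₊).toOuterMeasure {x | (C n).eval x = false})
          atTop (nhds 0)) →
    ∃ C' : (n : ℕ) → Circuit ((⊤ : SimpleGraph (Fin n)).edgeSet),
        (∀ᶠ n : ℕ in atTop, (C' n).IsOver monotoneBasis01 ∧ (C' n).size ≤ (s n + n) ^ a) ∧
        Tendsto (fun n : ℕ => (erdosRenyiHalf n).toOuterMeasure {x | (C' n).eval x = true} +
          (plantedCliqueDist n ⌈(n : ℝ) ^ (1 / 2 - δ)⌉₊).toOuterMeasure {x | (C' n).eval x = false})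
          atTop (nhds 0) := by
  intro _
  obtain ⟨M, hM, hT⟩ := karlinRubin_bruteForce_monotone_detector hδ hδ'
  refine ⟨M, ?_, hT⟩
  filter_upwards [hM, hs] with n hn hsn
  exact ⟨hn.1, hn.2.trans hsn⟩

end Summit.PneNP.PneNP.Theorems
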